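import Summits.QuantumFields.YangMills.Theorems.BalabanUVNodesN15KingModelCoverFineOperator
import Summits.QuantumFields.YangMills.Theorems.BalabanUVNodesN15KingModelToronGauge
import HarnessLib

/-!
# BalabanUVNodes ∕ N15 — THE KING-MODEL RUNG (PART Ͻ-d): FINITE COVERS — A TORON WHOSE PHASES ARE `K′`-TH ROOTS OF UNITY IS A PURE (CHARACTER) GAUGE ON `T_{K′}`:
# `−cΔ_ω + m² = D_p^*·(c(−Δ) + m²)·D_p`, `G_ω(x̃,ỹ) = χ̄_p(x̃)·(lapF K′)⁻¹(x̃,ỹ)·χ_p(ỹ)`; hence on the BASE torus `T_K` (`K ∣ K′`) THE TORON COVARIANCE IS A FINITE CHARACTER-IMAGE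
# SUM OF KING's `A = 0` COVARIANCE OF THE COVER — the curved (flat, holonomy) case reduced to King's printed `U ≡ 1` kernel by name
# (Track A, DAG node N15 = NE2; FAN-OUT v1.1 §N15 s3 «KING-MODEL RUNG … + what the curved case adds»; count-neutral)

HONEST FRAMING.  Count-neutral (cell `pub-ymgap`, seat `pub-ymgap-dag-n15-e` g45; `--supports stmt-QuantumFields-27247 --as helper` = K3ᴬ, KEY MAP v3).  King's `A = 0`
comparison model [King1986], FINE covariance layer, at a constant abelian (flat) link field with phases `ω_μ`; exact finite-dimensional identities on finite tori.  NOT Bałaban's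
`G_k(U)`; NOT a node discharge (N15 of record untouched); nothing continuum ∕ ℝ⁴ ∕ OS ∕ Clay.

THE MATHEMATICS.  If `ω_μ^{K′_μ} = 1` for all `μ` then `ω_μ = e^{2πi p_μ∕K′_μ} = χ_p(e_μ)` for some dual-lattice point `p ∈ T_{K′}` (Ͷ-c `exists_stdAddChar_eq_of_pow_eq_one`), and the
toron on `T_{K′}` is the CHARACTER GAUGE of the trivial field: with `D_p = diag(χ_p)` (unitary), `M_ω = D_p^*M_1D_p` (check on the stencil: `χ̄_p(x)χ_p(x ± e_μ) = χ_p(±e_μ) =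
ω_μ^{±1}`), so `G_ω = D_p^*G_1D_p`, i.e. `G_ω(x̃,ỹ) = χ̄_p(x̃)G_1(x̃,ỹ)χ_p(ỹ)` with `G_1 = (lapF K′ c m²)⁻¹` King's `A = 0` covariance (tree `lapF_inv_eq_kingPlaneWave`, Ͷ-b
`toronOp_inv_apply_eq`).  This is PART Ͷ-c's classification «gauge classes = holonomies» ([Balaban1985BackgroundPropagators] p.398 l.19 gauge covariance; twisted boundary
conditions [tHooft1979Flux]) made EXPLICIT at trivial holonomy.  Combined with PART Ͻ-c's method of images for the covering `T_{K′} → T_K`: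
`G^K_ω(π x̃, y) = Σ_{ỹ : π ỹ = y} χ̄_p(x̃)·(lapF K′)⁻¹(x̃, ỹ)·χ_p(ỹ)` — EVERY toron of finite-order holonomy on `T_K` is read off King's printed `U ≡ 1` kernel of a finite cover.
PROVED HERE:
* §1 `chi_neg_right`, `conj_chi_mul_chi_add`∕`_sub` (transport phases of a character gauge), `norm_eq_one_of_pow_period` (`ω_μ^{K_μ} = 1 ⇒ |ω_μ| = 1`), ★ `exists_char_of_pow_eq_one`
  (`ω_μ^{K_μ} = 1 ∀μ ⇒ ∃ p, χ_p(e_μ) = ω_μ`);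
* §2 ★★★ **`toronOp_eq_char_conj`** (`M_ω = D_p^*·M_1·D_p` whenever `χ_p(e_μ) = ω_μ`), `charDiag_mul_conjTranspose`∕`conjTranspose_mul_charDiag` (`D_p` unitary), ★★★
  **`toronOp_inv_eq_char_conj`** (`G_ω = D_p^*·G_1·D_p`), ★★ `toronOp_one_inv_apply` (`G_1(x,y) = (lapF K c m²)⁻¹(x,y)` as a complex number — Ͷ-b∕Ε-e by name), ★★★
  **`toronOp_inv_apply_eq_char`** (`G_ω(x,y) = χ̄_p(x)·(lapF)⁻¹(x,y)·χ_p(y)`), ★ `norm_toronOp_inv_apply_eq` (`|G_ω(x,y)| = |(lapF)⁻¹(x,y)|` — at trivial holonomy the curved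
  covariance has EXACTLY King's moduli);
* §3 ON THE BASE: ★★★ **`toronOp_inv_apply_eq_charSum_cover`** (`K ∣ K′`, `ω_μ^{K′_μ} = 1`: the finite character-image sum above), ★★ **`norm_toronOp_inv_apply_le_sum_lapF_cover`**
  (`|G^K_ω(π x̃, y)| ≤ Σ_{fibre}|(lapF K′)⁻¹(x̃,ỹ)|`), `toronOp_inv_apply_eq_charSum_cover'` (canonical lift).
PRIOR TREE ART (by name): Ͻ-a (`Lifts.apply_eq_sum_fiber`, `fiber`), Ͻ-b (`proj`, `lift`, `proj_lift`), Ͻ-c (`toronOp_inv_lifts`, `toronOp_inv_apply_eq_sum_cover`), Ͷ-a (`toronOp`,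
`toronOp_mulVec_complex`, `toronOp_posDef`), Ͷ-b (`toronOp_inv_apply_eq`, `toronKernel_zero`), Ͷ-c (`exists_stdAddChar_eq_of_pow_eq_one`, `chi_mul_conj`), Ε-e (`lapF_inv_eq_kingPlaneWave`),
`B5Prop11Plancherel` (`chi`, `chi_add_right`, `chi_unitVec`, `conj_chi`, `chi_neg_neg`), `B5ToronMomentum161.twistOf_zero`, Mathlib (`Complex.norm_eq_one_of_pow_eq_one`,
`Matrix.ext_iff_mulVec`, `diagonal_conjTranspose`, `mulVec_diagonal`, `diagonal_mul`, `mul_diagonal`).  Dedup (rg at filing): basename 0 files; needles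
`toronOp_eq_char_conj|toronOp_inv_apply_eq_char|charSum_cover|exists_char_of_pow_eq_one` 0 tree files.  presearch: n/a (composition of in-tree theorems).  Locators: [King1986] (4.4)
p.670, (4.35) p.674; [Balaban1985BackgroundPropagators] p.398 l.19, (3.23) p.394; [Balaban1984PropagatorsI] (1.29) p.23; [tHooft1979Flux] NPB 153 (notion only).
0 `sorry`, 0 `def`.
v1.1 (DOC-ONLY, ERRATUM-Ͻ1 = ref-I READ-1034 N2): v1.0 cited «[King1986] §4 p.670 l.8–13» as «the method of images»; King's lines invoke [Ba 4]'s MULTIPLE-REFLECTION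
representations (box propagators ∕ free boundary conditions ∕ the (2.13) operator on `ηℤ^d`, `A = 0`), not a periodisation — the finite-cover image sum is an elementary device of these files
([folklore]); that locator is withdrawn from the affected docstrings, every other locator stands; declarations byte-identical to v1.0.
-/

noncomputable section

open scoped BigOperators ComplexConjugate ComplexOrder
open Finset Matrix Complex

namespace Summit.QuantumFields.YangMills.BalabanUVNodes.N15KingModelRung.Cover

open Literature.MathematicalPhysics.QuantumFieldTheory.Balaban1983to89.B5Prop11Plancherel (Tor unitVec chi chi_add_right chi_unitVec conj_chi chi_neg_neg)
open Literature.MathematicalPhysics.QuantumFieldTheory.Balaban1983to89.B5ToronMomentum161 (twistOf twistOf_zero)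
open Literature.MathematicalPhysics.QuantumFieldTheory.King1986.Torus (lapF)
open Summit.QuantumFields.YangMills.BalabanUVNodes.N15KingModelRung.Toron (toronOp toronOp_mulVec_complex toronOp_posDef toronOp_inv_apply_eq toronKernel_zero
  exists_stdAddChar_eq_of_pow_eq_one chi_mul_conj)
open Summit.QuantumFields.YangMills.BalabanUVNodes.N15KingModelRung.TorusSpectral (lapF_inv_eq_kingPlaneWave norm_chi_eq_one)

variable {d : ℕ} (K : Fin (d + 1) → ℕ) [hK : ∀ μ, NeZero (K μ)]

/-! ## §1 Characters as transport phases -/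

/-- `χ_p(−y) = χ̄_p(y)`. [folklore] -/
theorem chi_neg_right (p y : Tor K) : chi K p (-y) = conj (chi K p y) := by
  rw [conj_chi, ← chi_neg_neg K (-p) y, neg_neg]

/-- `χ̄_p(x)·χ_p(x) = 1`. [folklore] -/
theorem conj_chi_mul_chi (p x : Tor K) : conj (chi K p x) * chi K p x = 1 := by
  rw [mul_comm]; exact chi_mul_conj K p x

/-- FORWARD TRANSPORT PHASE of the character gauge: `χ̄_p(x)·χ_p(x + e_μ) = χ_p(e_μ)`. [cite: Balaban1985BackgroundPropagators, p.398 l.19] -/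
theorem conj_chi_mul_chi_add (p x : Tor K) (μ : Fin (d + 1)) : conj (chi K p x) * chi K p (x + unitVec K μ) = chi K p (unitVec K μ) := by
  rw [chi_add_right, ← mul_assoc, conj_chi_mul_chi, one_mul]

/-- BACKWARD TRANSPORT PHASE: `χ̄_p(x)·χ_p(x − e_μ) = χ̄_p(e_μ)`. [cite: Balaban1985BackgroundPropagators, p.398 l.19] -/
theorem conj_chi_mul_chi_sub (p x : Tor K) (μ : Fin (d + 1)) : conj (chi K p x) * chi K p (x - unitVec K μ) = conj (chi K p (unitVec K μ)) := by
  rw [sub_eq_add_neg, chi_add_right, ← mul_assoc, conj_chi_mul_chi, one_mul, chi_neg_right]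

/-- A phase whose `K_μ`-th power is one has modulus one (`K_μ ≥ 1`). [folklore] -/
theorem norm_eq_one_of_pow_period {ω : Fin (d + 1) → ℂ} (hω : ∀ μ, ω μ ^ K μ = 1) (μ : Fin (d + 1)) : ‖ω μ‖ = 1 :=
  Complex.norm_eq_one_of_pow_eq_one (hω μ) (NeZero.ne (K μ))

/-- ★ **ROOT-OF-UNITY PHASES ARE CHARACTER VALUES**: `ω_μ^{K_μ} = 1 ∀μ ⇒ ∃ p ∈ T_K, χ_p(e_μ) = ω_μ ∀μ` (`χ_p(e_μ) = e^{2πip_μ∕K_μ}`). [cite: Balaban1984PropagatorsI, (1.29) p.23] -/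
theorem exists_char_of_pow_eq_one {ω : Fin (d + 1) → ℂ} (hω : ∀ μ, ω μ ^ K μ = 1) : ∃ p : Tor K, ∀ μ, chi K p (unitVec K μ) = ω μ := by
  choose j hj using fun μ => exists_stdAddChar_eq_of_pow_eq_one K μ (hω μ)
  exact ⟨fun μ => j μ, fun μ => by rw [chi_unitVec]; exact hj μ⟩

/-! ## §2 The toron as a character gauge of King's `U ≡ 1` operator -/

/-- ★★★ **`−cΔ_ω + m² = D_p^*·(−cΔ_1 + m²)·D_p`** whenever `χ_p(e_μ) = ω_μ` (`D_p = diag(χ_p)`): the toron is the character gauge of the trivial field — checked on King's stencil,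
the transport phases being `χ̄_p(x)χ_p(x ± e_μ) = ω_μ^{±1}`. [cite: Balaban1985BackgroundPropagators, p.398 l.19, (3.23) p.394; King1986, (4.4) p.670] -/
theorem toronOp_eq_char_conj (c m2 : ℝ) {p : Tor K} {ω : Fin (d + 1) → ℂ} (hω : ∀ μ, chi K p (unitVec K μ) = ω μ) :
    toronOp K c m2 ω = (diagonal (chi K p))ᴴ * toronOp K c m2 (1 : Fin (d + 1) → ℂ) * diagonal (chi K p) := by
  refine Matrix.ext_iff_mulVec.mpr fun f => funext fun x => ?_
  have hD : ∀ (g : Tor K → ℂ) (z : Tor K), (diagonal (chi K p) *ᵥ g) z = chi K p z * g z := fun g z => Matrix.mulVec_diagonal _ _ _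
  rw [← Matrix.mulVec_mulVec, ← Matrix.mulVec_mulVec, Matrix.diagonal_conjTranspose, Matrix.mulVec_diagonal, toronOp_mulVec_complex, toronOp_mulVec_complex]
  simp only [hD, Pi.one_apply, one_mul, map_one, Pi.star_apply, Complex.star_def]
  have h1 : ∀ μ, conj (chi K p x) * chi K p (x + unitVec K μ) = ω μ := fun μ => by rw [conj_chi_mul_chi_add, hω]
  have h2 : ∀ μ, conj (chi K p x) * chi K p (x - unitVec K μ) = conj (ω μ) := fun μ => by rw [conj_chi_mul_chi_sub, hω]
  set A : ℂ := ((m2 + 2 * ((d : ℝ) + 1) * c : ℝ) : ℂ)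
  calc A * f x - (c : ℂ) * ∑ μ, (ω μ * f (x + unitVec K μ) + conj (ω μ) * f (x - unitVec K μ))
      = A * (conj (chi K p x) * chi K p x) * f x
          - (c : ℂ) * ∑ μ, (conj (chi K p x) * chi K p (x + unitVec K μ) * f (x + unitVec K μ)
              + conj (chi K p x) * chi K p (x - unitVec K μ) * f (x - unitVec K μ)) := by
        rw [conj_chi_mul_chi, mul_one]; simp_rw [h1, h2]
    _ = conj (chi K p x) * (A * (chi K p x * f x)
          - (c : ℂ) * ∑ μ, (chi K p (x + unitVec K μ) * f (x + unitVec K μ) + chi K p (x - unitVec K μ) * f (x - unitVec K μ))) := by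
        rw [mul_sub, Finset.mul_sum, Finset.mul_sum, Finset.mul_sum]
        congr 1
        · ring
        · refine Finset.sum_congr rfl fun μ _ => ?_
          ring

/-- `D_p·D_p^* = 1` (`|χ_p| = 1`). [folklore] -/
theorem charDiag_mul_conjTranspose (p : Tor K) : diagonal (chi K p) * (diagonal (chi K p))ᴴ = 1 := by
  rw [Matrix.diagonal_conjTranspose, Matrix.diagonal_mul_diagonal, ← Matrix.diagonal_one]
  congr 1; funext x
  rw [Pi.star_apply, Complex.star_def, chi_mul_conj]

/-- `D_p^*·D_p = 1`. [folklore] -/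
theorem conjTranspose_mul_charDiag (p : Tor K) : (diagonal (chi K p))ᴴ * diagonal (chi K p) = 1 := by
  rw [Matrix.diagonal_conjTranspose, Matrix.diagonal_mul_diagonal, ← Matrix.diagonal_one]
  congr 1; funext x
  rw [Pi.star_apply, Complex.star_def, conj_chi_mul_chi]

/-- The trivial phase vector has unit moduli. [folklore] -/
theorem norm_one_phase (μ : Fin (d + 1)) : ‖(1 : Fin (d + 1) → ℂ) μ‖ = 1 := by simp

/-- ★★★ **`G_ω = D_p^*·G_1·D_p`**: the toron covariance is the character gauge of King's `A = 0` covariance (`χ_p(e_μ) = ω_μ`, `c ≥ 0`, `m² > 0`).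
[cite: Balaban1985BackgroundPropagators, p.398 l.19; King1986, (4.4) p.670] -/
theorem toronOp_inv_eq_char_conj {c m2 : ℝ} (hc : 0 ≤ c) (hm : 0 < m2) {p : Tor K} {ω : Fin (d + 1) → ℂ} (hω : ∀ μ, chi K p (unitVec K μ) = ω μ) :
    (toronOp K c m2 ω)⁻¹ = (diagonal (chi K p))ᴴ * (toronOp K c m2 (1 : Fin (d + 1) → ℂ))⁻¹ * diagonal (chi K p) := by
  have hu : IsUnit (toronOp K c m2 (1 : Fin (d + 1) → ℂ)).det :=
    (Matrix.isUnit_iff_isUnit_det _).mp (toronOp_posDef K hc hm (norm_one_phase (d := d))).isUnit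
  refine Matrix.inv_eq_left_inv ?_
  rw [toronOp_eq_char_conj K c m2 hω]
  calc (diagonal (chi K p))ᴴ * (toronOp K c m2 1)⁻¹ * diagonal (chi K p) * ((diagonal (chi K p))ᴴ * toronOp K c m2 1 * diagonal (chi K p))
      = (diagonal (chi K p))ᴴ * (toronOp K c m2 1)⁻¹ * (diagonal (chi K p) * (diagonal (chi K p))ᴴ) * toronOp K c m2 1 * diagonal (chi K p) := by
        simp only [Matrix.mul_assoc]
    _ = 1 := by
        rw [charDiag_mul_conjTranspose, Matrix.mul_one, Matrix.mul_assoc _ ((toronOp K c m2 1)⁻¹), Matrix.nonsing_inv_mul _ hu, Matrix.mul_one,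
          conjTranspose_mul_charDiag]

/-- ★★ **KING's `A = 0` COVARIANCE BY NAME**: `G_1(x,y) = (lapF K c m²)⁻¹(x,y)` (the toron at `ω ≡ 1` is King's free field; Ͷ-b `toronOp_inv_apply_eq` + `toronKernel_zero` + Ε-e
`lapF_inv_eq_kingPlaneWave`). [cite: King1986, (4.4) p.670, (4.35) p.674] -/
theorem toronOp_one_inv_apply {c m2 : ℝ} (hc : 0 ≤ c) (hm : 0 < m2) (x y : Tor K) :
    (toronOp K c m2 (1 : Fin (d + 1) → ℂ))⁻¹ x y = (((lapF K c m2)⁻¹ x y : ℝ) : ℂ) := by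
  rw [← twistOf_zero, toronOp_inv_apply_eq K hc hm, toronKernel_zero, lapF_inv_eq_kingPlaneWave K hc hm]

/-- ★★★ **THE TORON COVARIANCE AT TRIVIAL HOLONOMY, ENTRYWISE**: `G_ω(x,y) = χ̄_p(x)·(lapF K c m²)⁻¹(x,y)·χ_p(y)` whenever `χ_p(e_μ) = ω_μ` — the curved (flat) case IS King's printed
kernel dressed by character phases. [cite: King1986, (4.4) p.670, (4.35) p.674; Balaban1985BackgroundPropagators, p.398 l.19] -/
theorem toronOp_inv_apply_eq_char {c m2 : ℝ} (hc : 0 ≤ c) (hm : 0 < m2) {p : Tor K} {ω : Fin (d + 1) → ℂ} (hω : ∀ μ, chi K p (unitVec K μ) = ω μ) (x y : Tor K) :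
    (toronOp K c m2 ω)⁻¹ x y = conj (chi K p x) * (((lapF K c m2)⁻¹ x y : ℝ) : ℂ) * chi K p y := by
  rw [toronOp_inv_eq_char_conj K hc hm hω, Matrix.mul_apply]
  simp only [Matrix.diagonal_conjTranspose, Matrix.diagonal_mul, Pi.star_apply, Complex.star_def, toronOp_one_inv_apply K hc hm]
  rw [Finset.sum_eq_single y (fun z _ hz => by rw [Matrix.diagonal_apply_ne _ hz, mul_zero]) (fun h => absurd (Finset.mem_univ y) h), Matrix.diagonal_apply_eq]

/-- ★ **AT TRIVIAL HOLONOMY THE MODULI ARE KING's EXACTLY**: `|G_ω(x,y)| = |(lapF K c m²)⁻¹(x,y)|` (`ω_μ^{K_μ} = 1`). [cite: King1986, (4.4) p.670; Balaban1985BackgroundPropagators, p.398 l.19] -/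
theorem norm_toronOp_inv_apply_eq {c m2 : ℝ} (hc : 0 ≤ c) (hm : 0 < m2) {ω : Fin (d + 1) → ℂ} (hω : ∀ μ, ω μ ^ K μ = 1) (x y : Tor K) :
    ‖(toronOp K c m2 ω)⁻¹ x y‖ = |(lapF K c m2)⁻¹ x y| := by
  obtain ⟨p, hp⟩ := exists_char_of_pow_eq_one K hω
  rw [toronOp_inv_apply_eq_char K hc hm hp, norm_mul, norm_mul, Complex.norm_conj,
    norm_chi_eq_one, norm_chi_eq_one, one_mul, mul_one, Complex.norm_real, Real.norm_eq_abs]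

/-! ## §3 On the base torus: the toron covariance as a finite character-image sum of King's `A = 0` covariance of the cover -/

section Base

variable {K} {K' : Fin (d + 1) → ℕ} [hK' : ∀ μ, NeZero (K' μ)]

/-- ★★★ **THE CHARACTER-IMAGE SUM**: for a covering `π : T_{K′} → T_K` (`K_μ ∣ K′_μ`) and a toron with `ω_μ^{K′_μ} = 1` (holonomy of finite order), with `p ∈ T_{K′}` such that
`χ_p(e_μ) = ω_μ`:  `G^K_ω(π x̃, y) = Σ_{ỹ : π ỹ = y} χ̄_p(x̃)·(lapF K′ c m²)⁻¹(x̃, ỹ)·χ_p(ỹ)` — the toron covariance on `T_K` is read off KING's PRINTED `U ≡ 1` KERNEL of the cover.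
[cite: King1986, (4.35) p.674; Balaban1984PropagatorsI, (1.29) p.23; Balaban1985BackgroundPropagators, p.398 l.19] -/
theorem toronOp_inv_apply_eq_charSum_cover (h : ∀ μ, K μ ∣ K' μ) {c m2 : ℝ} (hc : 0 ≤ c) (hm : 0 < m2) {p : Tor K'} {ω : Fin (d + 1) → ℂ}
    (hp : ∀ μ, chi K' p (unitVec K' μ) = ω μ) (hω : ∀ μ, ω μ ^ K' μ = 1) (x' : Tor K') (y : Tor K) :
    (toronOp K c m2 ω)⁻¹ (proj h x') y = ∑ y' ∈ fiber (proj h) y, conj (chi K' p x') * ((((lapF K' c m2)⁻¹ x' y' : ℝ) : ℂ)) * chi K' p y' := by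
  rw [toronOp_inv_apply_eq_sum_cover h hc hm (norm_eq_one_of_pow_period K' hω) x' y]
  exact Finset.sum_congr rfl fun y' _ => toronOp_inv_apply_eq_char K' hc hm hp x' y'

/-- The same with the canonical lift of the base point. [folklore] -/
theorem toronOp_inv_apply_eq_charSum_cover' (h : ∀ μ, K μ ∣ K' μ) {c m2 : ℝ} (hc : 0 ≤ c) (hm : 0 < m2) {p : Tor K'} {ω : Fin (d + 1) → ℂ}
    (hp : ∀ μ, chi K' p (unitVec K' μ) = ω μ) (hω : ∀ μ, ω μ ^ K' μ = 1) (x y : Tor K) :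
    (toronOp K c m2 ω)⁻¹ x y = ∑ y' ∈ fiber (proj h) y, conj (chi K' p (lift h x)) * ((((lapF K' c m2)⁻¹ (lift h x) y' : ℝ) : ℂ)) * chi K' p y' := by
  conv_lhs => rw [← proj_lift h x]
  exact toronOp_inv_apply_eq_charSum_cover h hc hm hp hω (lift h x) y

/-- ★★ **ENTRYWISE MAJORANT FROM KING's KERNEL OF THE COVER**: `|G^K_ω(π x̃, y)| ≤ Σ_{ỹ : π ỹ = y} |(lapF K′ c m²)⁻¹(x̃, ỹ)|` for every toron of finite-order holonomy
(`ω_μ^{K′_μ} = 1`) — every printed decay estimate for King's `A = 0` covariance on `T_{K′}` periodises to the toron covariance on `T_K`. [folklore] -/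
theorem norm_toronOp_inv_apply_le_sum_lapF_cover (h : ∀ μ, K μ ∣ K' μ) {c m2 : ℝ} (hc : 0 ≤ c) (hm : 0 < m2) {ω : Fin (d + 1) → ℂ} (hω : ∀ μ, ω μ ^ K' μ = 1)
    (x' : Tor K') (y : Tor K) :
    ‖(toronOp K c m2 ω)⁻¹ (proj h x') y‖ ≤ ∑ y' ∈ fiber (proj h) y, |(lapF K' c m2)⁻¹ x' y'| := by
  refine (norm_toronOp_inv_apply_le_sum_cover h hc hm (norm_eq_one_of_pow_period K' hω) x' y).trans (le_of_eq ?_)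
  exact Finset.sum_congr rfl fun y' _ => norm_toronOp_inv_apply_eq K' hc hm hω x' y'

/-- A decay majorant for King's kernel on the cover transfers to the toron on the base: `|(lapF K′)⁻¹(x̃,ỹ)| ≤ F(x̃,ỹ) ⇒ |G^K_ω(π x̃, y)| ≤ Σ_{fibre}F`. [folklore] -/
theorem norm_toronOp_inv_apply_le_of_lapF_cover (h : ∀ μ, K μ ∣ K' μ) {c m2 : ℝ} (hc : 0 ≤ c) (hm : 0 < m2) {ω : Fin (d + 1) → ℂ} (hω : ∀ μ, ω μ ^ K' μ = 1)
    {F : Tor K' → Tor K' → ℝ} (hF : ∀ x' y', |(lapF K' c m2)⁻¹ x' y'| ≤ F x' y') (x' : Tor K') (y : Tor K) :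
    ‖(toronOp K c m2 ω)⁻¹ (proj h x') y‖ ≤ ∑ y' ∈ fiber (proj h) y, F x' y' :=
  (norm_toronOp_inv_apply_le_sum_lapF_cover h hc hm hω x' y).trans (Finset.sum_le_sum fun y' _ => hF x' y')

end Base

end Summit.QuantumFields.YangMills.BalabanUVNodes.N15KingModelRung.Cover

end
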